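import Summits.CriticalPhenomena.PercolationContinuityZ3.Theorems.PercNearOneGluingNoHeavyLowerTailSahiCombTriWIdxSplit
import Summits.CriticalPhenomena.PercolationContinuityZ3.Theorems.PercNearOneGluingNoHeavyLowerTailSahiCombTriWStrataTwo

/-!
# `TriWIneq` when the two families share at most one essential index coordinate — an unconditional stratum for every `a`, `n`, `P`

Support file of the one-cut programme (crux `NoHeavyLowerTail`, stmt-CriticalPhenomena-4575; TRI lane of cell `prim-masterthm`, seat P5 gen 25;
memo `FROM-prim-masterthm-p5-g25-CYLINDER-CLOSURE.md` §1b).  Continuation of `…SahiCombTriWIdxSplit` (index splitting: a family that ignores an index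
coordinate splits `triW` over the two index faces).

Say that a family `F : Finset β → Finset (Finset γ)` IGNORES the index coordinate `o : β` if `F (insert o x) = F x` whenever `o ∉ x`
(`FiveUpSet.IgnoresIdx`).  **Theorem (`triW_nonneg_of_shared_le_one`).**  If every index coordinate outside a set `S` with `#S ≤ 1` is ignored by `F`
or by `G`, then `0 ≤ triW P F G` for every up-set `P` and all monotone families of up-sets `F, G` — on EVERY index cube and every fibre cube.  (The two
families share at most one essential coordinate; each family separately may depend on arbitrarily many coordinates.)  Proof: induction on `#β`: transport
along `Equiv.optionSubtypeNe o : Option {b // b ≠ o} ≃ β` (`triW_comp_equiv`: `triW` is invariant under relabelling the index coordinates), split off the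
coordinate `o ∉ S` with the index-splitting identity of `…TriWIdxSplit` (for `F` or for `G`), observe that the face families inherit the hypothesis, and finish
with the thin-edge theorem `triW_nonneg_of_card_eq_one` (`#β = 1`) or the degenerate cube (`#β = 0`).  This contains the thin edge (`a = 1`), the tower form
`triW_nonneg_of_dependsOnBase`, and e.g. all pairs `F = Φ(x ∩ I₁)`, `G = Ψ(x ∩ I₂)` with `#(I₁ ∩ I₂) ≤ 1`; it is not contained in the co-nested / anti-nested /
swap-pair / self-dual strata of the tree.
HONEST LABEL: one new unconditional stratum of `FiveUpSet.TriWIneq` (std axioms); the conjecture itself (both families essential in ≥ 2 common coordinates)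
stays OPEN. [this work]
-/

namespace Summit.CriticalPhenomena.PercolationContinuityZ3.Theorems

namespace FiveUpSet

open Finset

variable {β γ : Type} [DecidableEq β] [Fintype β] [DecidableEq γ] [Fintype γ]

/-! ### Ignored index coordinates -/

/-- `F` ignores the index coordinate `o`: adding `o` to an index point never changes the value. [this work] -/
def IgnoresIdx (F : Finset β → Finset (Finset γ)) (o : β) : Prop := ∀ x : Finset β, o ∉ x → F (insert o x) = F x

/-! ### Relabelling the index coordinates -/

omit [Fintype γ] [DecidableEq γ] in
/-- Complement commutes with relabelling along an equivalence. [this work] -/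
theorem map_equiv_compl {β' : Type} [DecidableEq β'] [Fintype β'] (e : β' ≃ β) (s : Finset β') :
    (sᶜ).map e.toEmbedding = (s.map e.toEmbedding)ᶜ := by
  ext b
  rw [mem_map_equiv, mem_compl, mem_compl, mem_map_equiv]

/-- **`triW` is invariant under relabelling the index coordinates** along an equivalence `e : β' ≃ β`. [this work] -/
theorem triW_comp_equiv {β' : Type} [DecidableEq β'] [Fintype β'] (e : β' ≃ β) (P : Finset (Finset γ)) (F G : Finset β → Finset (Finset γ)) :
    triW P (fun x' => F (x'.map e.toEmbedding)) (fun x' => G (x'.map e.toEmbedding)) = triW P F G := by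
  unfold triW
  refine Fintype.sum_equiv (Equiv.finsetCongr e) _ _ fun x' => ?_
  unfold triWTerm
  simp only [Equiv.finsetCongr_apply, map_equiv_compl]

omit [Fintype γ] [DecidableEq γ] [Fintype β] [DecidableEq β] in
/-- Relabelled families are monotone. [this work] -/
theorem monotone_comp_map {β' : Type} (ι : β' ↪ β) {F : Finset β → Finset (Finset γ)} (hFm : Monotone F) :
    Monotone (fun x' : Finset β' => F (x'.map ι)) :=
  fun _ _ hxy => hFm (map_subset_map.2 hxy)

omit [Fintype γ] [DecidableEq γ] [Fintype β] in
/-- The family `x' ↦ F (insert o (x'.map ι))` is monotone. [this work] -/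
theorem monotone_comp_insert_map {β' : Type} (ι : β' ↪ β) (o : β) {F : Finset β → Finset (Finset γ)} (hFm : Monotone F) :
    Monotone (fun x' : Finset β' => F (insert o (x'.map ι))) :=
  fun _ _ hxy => hFm (insert_subset_insert o (map_subset_map.2 hxy))

/-! ### The two index faces at a coordinate `o` -/

/-- The embedding of `{b // b ≠ o}` into `β`. [this work] -/
def neEmb (o : β) : {b // b ≠ o} ↪ β := ⟨Subtype.val, Subtype.val_injective⟩

omit [Fintype β] [DecidableEq β] [DecidableEq γ] [Fintype γ] in
/-- `o` is not in the image of a finset of `{b // b ≠ o}`. [this work] -/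
theorem not_mem_map_neEmb (o : β) (x' : Finset {b // b ≠ o}) : o ∉ x'.map (neEmb o) := by
  intro h
  obtain ⟨b, -, hb⟩ := mem_map.1 h
  exact b.property hb

omit [Fintype β] [DecidableEq γ] [Fintype γ] in
/-- Relabelling through `Equiv.optionSubtypeNe o`: the lower copy `x'.map some` goes to `x'.map val`. [this work] -/
theorem map_some_map_optionSubtypeNe (o : β) (x' : Finset {b // b ≠ o}) :
    (x'.map Function.Embedding.some).map (Equiv.optionSubtypeNe o).toEmbedding = x'.map (neEmb o) := by
  ext b
  simp only [mem_map, Function.Embedding.some_apply, neEmb, Function.Embedding.coeFn_mk]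
  constructor
  · rintro ⟨y, ⟨b', hb', rfl⟩, rfl⟩
    exact ⟨b', hb', rfl⟩
  · rintro ⟨b', hb', rfl⟩
    exact ⟨some b', ⟨b', hb', rfl⟩, rfl⟩

omit [Fintype β] [DecidableEq γ] [Fintype γ] in
/-- Relabelling through `Equiv.optionSubtypeNe o`: the upper copy `insertNone x'` goes to `insert o (x'.map val)`. [this work] -/
theorem map_insertNone_optionSubtypeNe (o : β) (x' : Finset {b // b ≠ o}) :
    (Finset.insertNone x').map (Equiv.optionSubtypeNe o).toEmbedding = insert o (x'.map (neEmb o)) := by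
  ext b
  simp only [mem_map, mem_insert, neEmb, Function.Embedding.coeFn_mk]
  constructor
  · rintro ⟨y, hy, rfl⟩
    cases y with
    | none => exact Or.inl rfl
    | some b' => exact Or.inr ⟨b', Finset.some_mem_insertNone.1 hy, rfl⟩
  · rintro (rfl | ⟨b', hb', rfl⟩)
    · exact ⟨none, Finset.none_mem_insertNone, rfl⟩
    · exact ⟨some b', Finset.some_mem_insertNone.2 hb', rfl⟩

omit [Fintype β] [DecidableEq γ] [Fintype γ] in
/-- Face families inherit ignored coordinates (lower face). [this work] -/
theorem ignoresIdx_faceLo {o : β} {F : Finset β → Finset (Finset γ)} {b : {b // b ≠ o}} (hF : IgnoresIdx F b.val) :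
    IgnoresIdx (fun x' : Finset {b // b ≠ o} => F (x'.map (neEmb o))) b := by
  intro x' hb
  show F ((insert b x').map (neEmb o)) = F (x'.map (neEmb o))
  rw [map_insert]
  exact hF _ (fun h => hb (by obtain ⟨b'', hb'', hval⟩ := mem_map.1 h; rwa [← Subtype.ext hval]))

omit [Fintype β] [DecidableEq γ] [Fintype γ] in
/-- Face families inherit ignored coordinates (upper face). [this work] -/
theorem ignoresIdx_faceHi {o : β} {F : Finset β → Finset (Finset γ)} {b : {b // b ≠ o}} (hF : IgnoresIdx F b.val) :
    IgnoresIdx (fun x' : Finset {b // b ≠ o} => F (insert o (x'.map (neEmb o)))) b := by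
  intro x' hb
  show F (insert o ((insert b x').map (neEmb o))) = F (insert o (x'.map (neEmb o)))
  rw [map_insert, Finset.insert_comm]
  refine hF _ (fun h => ?_)
  rcases mem_insert.1 h with h | h
  · exact b.property h
  · exact hb (by obtain ⟨b'', hb'', hval⟩ := mem_map.1 h; rwa [← Subtype.ext hval])

/-! ### The splitting at an ignored coordinate, in intrinsic form -/

/-- If `F` ignores `o`, then `triW P F G` is the sum of the two face functionals on the index cube `{b // b ≠ o}`:
faces `x' ↦ F (x'.map val)` (= `F` on both copies) against `x' ↦ G (x'.map val)` and `x' ↦ G (insert o (x'.map val))`. [this work] -/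
theorem triW_eq_add_of_ignoresIdx (P : Finset (Finset γ)) (F G : Finset β → Finset (Finset γ)) (o : β) (hF : IgnoresIdx F o) :
    triW P F G = triW P (fun x' : Finset {b // b ≠ o} => F (x'.map (neEmb o))) (fun x' => G (x'.map (neEmb o)))
      + triW P (fun x' : Finset {b // b ≠ o} => F (x'.map (neEmb o))) (fun x' => G (insert o (x'.map (neEmb o)))) := by
  rw [← triW_comp_equiv (Equiv.optionSubtypeNe o) P F G]
  have hFi : ∀ x' : Finset {b // b ≠ o}, F ((Finset.insertNone x').map (Equiv.optionSubtypeNe o).toEmbedding)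
      = F ((x'.map Function.Embedding.some).map (Equiv.optionSubtypeNe o).toEmbedding) := by
    intro x'
    rw [map_insertNone_optionSubtypeNe, map_some_map_optionSubtypeNe]
    exact hF _ (not_mem_map_neEmb o x')
  rw [triW_eq_add_of_idx_indep P _ _ hFi]
  simp only [map_some_map_optionSubtypeNe, map_insertNone_optionSubtypeNe]

/-! ### The theorem -/

/-- **`TriWIneq` when the two families share at most one essential index coordinate.**  For every finite index type `β`, every up-set `P`, all
monotone families of up-sets `F, G : Finset β → Finset (Finset γ)`: if there is a set `S` of index coordinates with `#S ≤ 1` such that every `o ∉ S` is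
ignored by `F` or by `G`, then `0 ≤ triW P F G`. [this work] -/
theorem triW_nonneg_of_shared_le_one :
    ∀ (k : ℕ) (β : Type) [DecidableEq β] [Fintype β], Fintype.card β = k →
    ∀ (P : Finset (Finset γ)), IsUpperSet (P : Set (Finset γ)) →
    ∀ (F G : Finset β → Finset (Finset γ)), (∀ x, IsUpperSet (F x : Set (Finset γ))) → (∀ x, IsUpperSet (G x : Set (Finset γ))) →
    Monotone F → Monotone G →
    ∀ (S : Finset β), S.card ≤ 1 → (∀ o, o ∉ S → IgnoresIdx F o ∨ IgnoresIdx G o) → 0 ≤ triW P F G := by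
  intro k
  induction k with
  | zero =>
    intro β _ _ hcard P hP F G hF hG hFm hGm S hS hign
    haveI : IsEmpty β := Fintype.card_eq_zero_iff.1 hcard
    refine triW_nonneg_of_pairwise_nested P F G hP hF hG fun x => Or.inl ⟨?_, ?_⟩
    · rw [Finset.eq_empty_of_isEmpty x, Finset.eq_empty_of_isEmpty (∅ : Finset β)ᶜ]
    · rw [Finset.eq_empty_of_isEmpty x, Finset.eq_empty_of_isEmpty (∅ : Finset β)ᶜ]
  | succ k ih =>
    intro β _ _ hcard P hP F G hF hG hFm hGm S hS hign
    cases k with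
    | zero => exact triW_nonneg_of_card_eq_one hcard P F G hP hF hG hFm hGm
    | succ k =>
      -- pick a coordinate outside S
      have hlt : S.card < (univ : Finset β).card := by
        rw [Finset.card_univ, hcard]; omega
      obtain ⟨o, -, hoS⟩ := exists_mem_notMem_of_card_lt_card hlt
      have hcard' : Fintype.card {b // b ≠ o} = k + 1 := by
        have h1 := Fintype.card_subtype_compl (fun b : β => b = o)
        have h2 : Fintype.card {b // b = o} = 1 := Fintype.card_subtype_eq o
        simp only [h2, hcard] at h1
        convert h1 using 2
        omega
      -- the hypothesis on the faces
      have hS' : (S.subtype (· ≠ o)).card ≤ 1 := (Finset.card_subtype _ _ |>.trans_le (card_filter_le _ _)).trans hS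
      have hignLo : ∀ b : {b // b ≠ o}, b ∉ S.subtype (· ≠ o) →
          IgnoresIdx (fun x' : Finset {b // b ≠ o} => F (x'.map (neEmb o))) b
            ∨ IgnoresIdx (fun x' : Finset {b // b ≠ o} => G (x'.map (neEmb o))) b := by
        intro b hb
        have hb' : b.val ∉ S := fun h => hb (Finset.mem_subtype.2 h)
        rcases hign b.val hb' with h | h
        · exact Or.inl (ignoresIdx_faceLo h)
        · exact Or.inr (ignoresIdx_faceLo h)
      rcases hign o hoS with hFo | hGo
      · rw [triW_eq_add_of_ignoresIdx P F G o hFo]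
        have hignHi : ∀ b : {b // b ≠ o}, b ∉ S.subtype (· ≠ o) →
            IgnoresIdx (fun x' : Finset {b // b ≠ o} => F (x'.map (neEmb o))) b
              ∨ IgnoresIdx (fun x' : Finset {b // b ≠ o} => G (insert o (x'.map (neEmb o)))) b := by
          intro b hb
          have hb' : b.val ∉ S := fun h => hb (Finset.mem_subtype.2 h)
          rcases hign b.val hb' with h | h
          · exact Or.inl (ignoresIdx_faceLo h)
          · exact Or.inr (ignoresIdx_faceHi h)
        exact add_nonneg
          (ih {b // b ≠ o} hcard' P hP _ _ (fun x' => hF _) (fun x' => hG _) (monotone_comp_map _ hFm) (monotone_comp_map _ hGm)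
            _ hS' hignLo)
          (ih {b // b ≠ o} hcard' P hP _ _ (fun x' => hF _) (fun x' => hG _) (monotone_comp_map _ hFm)
            (monotone_comp_insert_map _ o hGm) _ hS' hignHi)
      · -- symmetric: G ignores o; use the symmetry of `triW` via the identity with the roles exchanged
        rw [triW_symm P F G, triW_eq_add_of_ignoresIdx P G F o hGo]
        have hignLo' : ∀ b : {b // b ≠ o}, b ∉ S.subtype (· ≠ o) →
            IgnoresIdx (fun x' : Finset {b // b ≠ o} => G (x'.map (neEmb o))) b
              ∨ IgnoresIdx (fun x' : Finset {b // b ≠ o} => F (x'.map (neEmb o))) b := by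
          intro b hb
          rcases hignLo b hb with h | h
          · exact Or.inr h
          · exact Or.inl h
        have hignHi' : ∀ b : {b // b ≠ o}, b ∉ S.subtype (· ≠ o) →
            IgnoresIdx (fun x' : Finset {b // b ≠ o} => G (x'.map (neEmb o))) b
              ∨ IgnoresIdx (fun x' : Finset {b // b ≠ o} => F (insert o (x'.map (neEmb o)))) b := by
          intro b hb
          have hb' : b.val ∉ S := fun h => hb (Finset.mem_subtype.2 h)
          rcases hign b.val hb' with h | h
          · exact Or.inr (ignoresIdx_faceHi h)
          · exact Or.inl (ignoresIdx_faceLo h)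
        exact add_nonneg
          (ih {b // b ≠ o} hcard' P hP _ _ (fun x' => hG _) (fun x' => hF _) (monotone_comp_map _ hGm) (monotone_comp_map _ hFm)
            _ hS' hignLo')
          (ih {b // b ≠ o} hcard' P hP _ _ (fun x' => hG _) (fun x' => hF _) (monotone_comp_map _ hGm)
            (monotone_comp_insert_map _ o hFm) _ hS' hignHi')


/-! ## Appendix (gen 25, v2): the quotable form -/

/-- **Corollary (supports form).**  If `F` ignores every index coordinate outside `I₁` and `G` ignores every index coordinate outside `I₂`, and
`#(I₁ ∩ I₂) ≤ 1`, then `0 ≤ triW P F G` — e.g. `F x = Φ (x ∩ I₁)`, `G x = Ψ (x ∩ I₂)` for arbitrary monotone families of up-sets `Φ, Ψ` whose supports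
share at most one coordinate.  (`S = I₁ ∩ I₂` in `triW_nonneg_of_shared_le_one`.) [this work] -/
theorem triW_nonneg_of_supports_inter_le_one (P : Finset (Finset γ)) (hP : IsUpperSet (P : Set (Finset γ)))
    (F G : Finset β → Finset (Finset γ)) (hF : ∀ x, IsUpperSet (F x : Set (Finset γ))) (hG : ∀ x, IsUpperSet (G x : Set (Finset γ)))
    (hFm : Monotone F) (hGm : Monotone G) (I₁ I₂ : Finset β)
    (hF₁ : ∀ o, o ∉ I₁ → IgnoresIdx F o) (hG₂ : ∀ o, o ∉ I₂ → IgnoresIdx G o) (hI : (I₁ ∩ I₂).card ≤ 1) :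
    0 ≤ triW P F G := by
  refine triW_nonneg_of_shared_le_one (Fintype.card β) β rfl P hP F G hF hG hFm hGm (I₁ ∩ I₂) hI fun o ho => ?_
  by_cases h1 : o ∈ I₁
  · exact Or.inr (hG₂ o fun h2 => ho (mem_inter.2 ⟨h1, h2⟩))
  · exact Or.inl (hF₁ o h1)

/-- **Corollary (one essential coordinate in common with everything): if `F` ignores all index coordinates but one, `0 ≤ triW P F G` for EVERY
monotone family of up-sets `G`** (the intrinsic form of `triW_nonneg_of_dependsOnBase` of `…TriWIdxSplit`). [this work] -/
theorem triW_nonneg_of_ignores_all_but_one (P : Finset (Finset γ)) (hP : IsUpperSet (P : Set (Finset γ)))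
    (F G : Finset β → Finset (Finset γ)) (hF : ∀ x, IsUpperSet (F x : Set (Finset γ))) (hG : ∀ x, IsUpperSet (G x : Set (Finset γ)))
    (hFm : Monotone F) (hGm : Monotone G) (o₀ : β) (hF₁ : ∀ o, o ≠ o₀ → IgnoresIdx F o) :
    0 ≤ triW P F G :=
  triW_nonneg_of_shared_le_one (Fintype.card β) β rfl P hP F G hF hG hFm hGm {o₀} (by rw [card_singleton])
    fun o ho => Or.inl (hF₁ o fun h => ho (by rw [h]; exact mem_singleton_self o₀))

end FiveUpSet

end Summit.CriticalPhenomena.PercolationContinuityZ3.Theorems
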